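import Mathlib
import HarnessLib
import Summits.MatrixMultiplication.MatrixMultiplication.Theses.OutsiderSandwich
import Summits.MatrixMultiplication.MatrixMultiplication.Theorems.OutsiderSandwichSlopeDialCore
import Summits.MatrixMultiplication.MatrixMultiplication.Theorems.OutsiderSandwichSlopeDial


/-!
# OutsiderSandwich — the TOP FLOOR and the top slope `μ*` (critic g14 ask s1, lens-4 g32)

Support kernel for route `OutsiderSandwich` (cut of record UNCHANGED:
`closes (h₁ : LaserTangency) (h₂ : LaserMergeOptimal) (h₃ : SummitIffLaserTangency)`).

The corner-slope dial of g31 (`OutsiderSandwichSlopeDialCore`) closes by evaluating the floor ONLY at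
the capped top point.  Hence the weaker, ω-relative **top floor**

  `TopFloor t a μ :≡ ∀ F universal with τ_F = ω,  a + μ (ω − 2) ≤ log₂ F(t)`

(written INLINE below — this file is definition-free) also closes the dial, is also necessary, and —
in the branch `ω > 2` — the attacked and residual sides become the two complementary half-lines of ONE
real number, the **top slope**

  `μ* := inf { (log₂ F(t) − a)/(ω − 2) : F universal, τ_F = ω }`   (a `sInf` over a nonempty set,
  bounded below by `0` as soon as the slope-`0` floor `SlopeFloor t a 0` holds):

* `TopFloor t a μ ⟺ μ ≤ μ*`                      (`topFloor_iff_le_sInf`, exact);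
* `SlopeCap t a μ' ⟹ μ* ≤ μ'` and `μ* < μ' ⟹ SlopeCap t a μ'`; `(∀ ε>0, SlopeCap t a (μ'+ε)) ⟺ μ* ≤ μ'`
  (`sInf_le_of_slopeCap`, `slopeCap_of_sInf_lt`, `forall_slopeCap_iff_sInf_le` — the inf-version; the
  attained version `SlopeCap t a μ' ⟺ μ* ≤ μ'` holds whenever the inf is a min, `slopeCap_iff_of_mem`);
* for `t = cw₂`, `a = log₂ 3`:  `1/3 ≤ μ* ≤ (2 − log₂3)/(ω − 2)`  (laser floor; `b = 2`), and the residual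
  of record reads  `LaserMergeOptimal ⟺ 1/3 ∈ (slope set)`  (`μ* = 1/3` AND attained), in particular
  `LaserMergeOptimal ⟹ μ* = 1/3` and `μ* = 1/3 ⟺ ∀ ε > 0, SlopeCap cw₂ (log₂3) (1/3 + ε)`.

No compactness of the top fibre is available for `SpectralMap` (values on infinite index types are
unconstrained), so attainment is NOT claimed; every statement is the inf-version.  Rung 0 on `ω`.

References: [cite: Strassen1988, Thm. 2.3–2.4] (support-function geometry of the asymptotic spectrum);
[cite: CoppersmithWinograd1990, §6] (the laser floor at slope `1/3`).
-/

namespace Summit.MatrixMultiplication.MatrixMultiplication.Theorems.OutsiderSandwichTopSlope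

open Literature.Computability.AlgebraicComplexity
open Summit.MatrixMultiplication.MatrixMultiplication.Theses.OutsiderSandwich
open Summit.MatrixMultiplication.MatrixMultiplication.Theorems.OutsiderSandwichLaserFloor
  (two_le_matExp)
open Summit.MatrixMultiplication.MatrixMultiplication.Theorems.OutsiderSandwichLaserFloorTop
  (exists_top_point)
open Summit.MatrixMultiplication.MatrixMultiplication.Theorems.OutsiderSandwichSlopeDialCore
open Summit.MatrixMultiplication.MatrixMultiplication.Theorems.OutsiderSandwichSlopeDial

section Generic

variable {ι κ μ : Type} [Fintype ι] [Fintype κ] [Fintype μ] {t : ι → κ → μ → ℂ} {a : ℝ}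

/-! ## §1  The top floor (ω-relative floor, evaluated at top points only) -/

/-- `SlopeFloor ⟹ TopFloor` (restrict the universal floor to the top fibre `τ_F = ω`).
[cite: Strassen1988, Thm. 2.4] -/
theorem topFloor_of_slopeFloor {s : ℝ} (h : SlopeFloor t a s) :
    ∀ F : SpectralMap ℂ, IsUniversalSpectralPoint ℂ F →
      Real.logb 2 (F (matMulTensor ℂ 2 2 2)) = omega ℂ → a + s * (omega ℂ - 2) ≤ Real.logb 2 (F t) := by
  intro F hF hFω
  have h1 := h F hF
  rwa [hFω] at h1

/-- **The dial closes from the TOP floor.**  For any slopes `μ' < μ`: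
`TopFloor t a μ ∧ SlopeCap t a μ' ⟹ ω = 2`. [cite: Strassen1988, Thm. 2.3–2.4] -/
theorem summit_of_topFloor_of_cap {s s' : ℝ} (hlt : s' < s)
    (htop : ∀ F : SpectralMap ℂ, IsUniversalSpectralPoint ℂ F →
      Real.logb 2 (F (matMulTensor ℂ 2 2 2)) = omega ℂ → a + s * (omega ℂ - 2) ≤ Real.logb 2 (F t))
    (hcap : SlopeCap t a s') : _root_.MatrixMultiplication := by
  obtain ⟨G, hG, hGω, hGcap⟩ := hcap
  have h1 := htop G hG hGω
  have h2 : (s - s') * (omega ℂ - 2) ≤ 0 := by nlinarith [h1, hGcap]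
  have h3 : omega ℂ - 2 ≤ 0 := nonpos_of_mul_nonpos_right (by nlinarith [h2]) (sub_pos.2 hlt)
  exact (_root_.MatrixMultiplication_iff).2 (le_antisymm (by linarith) two_le_omega)

/-- **Necessity of every top floor** (given the slope-`0` floor). [cite: Strassen1988, Thm. 2.4] -/
theorem topFloor_of_summit (hS : _root_.MatrixMultiplication) (h0 : SlopeFloor t a 0) (s : ℝ) :
    ∀ F : SpectralMap ℂ, IsUniversalSpectralPoint ℂ F →
      Real.logb 2 (F (matMulTensor ℂ 2 2 2)) = omega ℂ → a + s * (omega ℂ - 2) ≤ Real.logb 2 (F t) :=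
  topFloor_of_slopeFloor (slopeFloor_of_summit hS h0 s)

/-- **The exact cut with the top floor**: for `μ' < μ`, `ω = 2 ⟺ TopFloor t a μ ∧ SlopeCap t a μ'`
(given the slope-`0` floor and a point of height `≤ a`). [cite: Strassen1988, Thm. 2.3–2.4] -/
theorem summit_iff_topFloor_and_cap {s s' : ℝ} (hlt : s' < s) (h0 : SlopeFloor t a 0)
    (ha : ∃ F : SpectralMap ℂ, IsUniversalSpectralPoint ℂ F ∧ Real.logb 2 (F t) ≤ a) :
    _root_.MatrixMultiplication ↔
      (∀ F : SpectralMap ℂ, IsUniversalSpectralPoint ℂ F →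
        Real.logb 2 (F (matMulTensor ℂ 2 2 2)) = omega ℂ → a + s * (omega ℂ - 2) ≤ Real.logb 2 (F t))
      ∧ SlopeCap t a s' :=
  ⟨fun hS => ⟨topFloor_of_summit hS h0 s, slopeCap_of_summit hS ha s'⟩,
    fun h => summit_of_topFloor_of_cap hlt h.1 h.2⟩

omit [Fintype ι] [Fintype κ] [Fintype μ] in
/-- The top floor is antitone in the slope (`ω ≥ 2`). [cite: Strassen1988, Thm. 2.4] -/
theorem topFloor_anti {s₁ s₂ : ℝ} (h : s₁ ≤ s₂)
    (h₂ : ∀ F : SpectralMap ℂ, IsUniversalSpectralPoint ℂ F →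
      Real.logb 2 (F (matMulTensor ℂ 2 2 2)) = omega ℂ → a + s₂ * (omega ℂ - 2) ≤ Real.logb 2 (F t)) :
    ∀ F : SpectralMap ℂ, IsUniversalSpectralPoint ℂ F →
      Real.logb 2 (F (matMulTensor ℂ 2 2 2)) = omega ℂ → a + s₁ * (omega ℂ - 2) ≤ Real.logb 2 (F t) := by
  intro F hF hFω
  have h1 := h₂ F hF hFω
  nlinarith [h1, mul_le_mul_of_nonneg_right h (sub_nonneg.2 two_le_omega)]

/-! ## §2  The top slope `μ* = sInf {(log₂F(t) − a)/(ω − 2) : τ_F = ω}` in the branch `ω > 2` -/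

omit [Fintype ι] [Fintype κ] [Fintype μ] in
/-- The slope set is nonempty (a top point exists: Strassen duality, attained on `⟨2,2,2⟩`).
[cite: Strassen1988, Thm. 3.8] -/
theorem slopeSet_nonempty :
    {x : ℝ | ∃ F : SpectralMap ℂ, IsUniversalSpectralPoint ℂ F ∧
      Real.logb 2 (F (matMulTensor ℂ 2 2 2)) = omega ℂ ∧
      (Real.logb 2 (F t) - a) / (omega ℂ - 2) = x}.Nonempty := by
  obtain ⟨G, hG, hGω⟩ := exists_top_point
  exact ⟨_, G, hG, hGω, rfl⟩

/-- Under the slope-`0` floor and `ω > 2`, the slope set is bounded below by `0`.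
[cite: Strassen1988, Thm. 2.4] -/
theorem slopeSet_bddBelow (hω : 2 < omega ℂ) (h0 : SlopeFloor t a 0) :
    BddBelow {x : ℝ | ∃ F : SpectralMap ℂ, IsUniversalSpectralPoint ℂ F ∧
      Real.logb 2 (F (matMulTensor ℂ 2 2 2)) = omega ℂ ∧
      (Real.logb 2 (F t) - a) / (omega ℂ - 2) = x} := by
  refine ⟨0, ?_⟩
  rintro x ⟨F, hF, -, rfl⟩
  have h1 := h0 F hF
  exact div_nonneg (by linarith) (sub_pos.2 hω).le

/-- **`TopFloor t a μ ⟺ μ ≤ μ*`** (exact; `ω > 2`, slope-`0` floor for boundedness).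
[cite: Strassen1988, Thm. 2.3–2.4] -/
theorem topFloor_iff_le_sInf (hω : 2 < omega ℂ) (h0 : SlopeFloor t a 0) {s : ℝ} :
    (∀ F : SpectralMap ℂ, IsUniversalSpectralPoint ℂ F →
      Real.logb 2 (F (matMulTensor ℂ 2 2 2)) = omega ℂ → a + s * (omega ℂ - 2) ≤ Real.logb 2 (F t)) ↔
    s ≤ sInf {x : ℝ | ∃ F : SpectralMap ℂ, IsUniversalSpectralPoint ℂ F ∧
      Real.logb 2 (F (matMulTensor ℂ 2 2 2)) = omega ℂ ∧
      (Real.logb 2 (F t) - a) / (omega ℂ - 2) = x} := by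
  have hpos : 0 < omega ℂ - 2 := sub_pos.2 hω
  rw [le_csInf_iff (slopeSet_bddBelow hω h0) slopeSet_nonempty]
  constructor
  · rintro h x ⟨F, hF, hFω, rfl⟩
    rw [le_div_iff₀ hpos]
    linarith [h F hF hFω]
  · intro h F hF hFω
    have h1 := h _ ⟨F, hF, hFω, rfl⟩
    rw [le_div_iff₀ hpos] at h1
    linarith

/-- **`SlopeCap t a μ' ⟹ μ* ≤ μ'`** (`ω > 2`). [cite: Strassen1988, Thm. 2.3–2.4] -/
theorem sInf_le_of_slopeCap (hω : 2 < omega ℂ) (h0 : SlopeFloor t a 0) {s' : ℝ}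
    (hcap : SlopeCap t a s') :
    sInf {x : ℝ | ∃ F : SpectralMap ℂ, IsUniversalSpectralPoint ℂ F ∧
      Real.logb 2 (F (matMulTensor ℂ 2 2 2)) = omega ℂ ∧
      (Real.logb 2 (F t) - a) / (omega ℂ - 2) = x} ≤ s' := by
  obtain ⟨G, hG, hGω, hGcap⟩ := hcap
  refine csInf_le_of_le (slopeSet_bddBelow hω h0) ⟨G, hG, hGω, rfl⟩ ?_
  rw [div_le_iff₀ (sub_pos.2 hω)]
  linarith

/-- **`μ* < μ' ⟹ SlopeCap t a μ'`** (`ω > 2`): a top point strictly under the slope-`μ'` line exists.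
[cite: Strassen1988, Thm. 2.3–2.4] -/
theorem slopeCap_of_sInf_lt (hω : 2 < omega ℂ) (h0 : SlopeFloor t a 0) {s' : ℝ}
    (hlt : sInf {x : ℝ | ∃ F : SpectralMap ℂ, IsUniversalSpectralPoint ℂ F ∧
      Real.logb 2 (F (matMulTensor ℂ 2 2 2)) = omega ℂ ∧
      (Real.logb 2 (F t) - a) / (omega ℂ - 2) = x} < s') :
    SlopeCap t a s' := by
  obtain ⟨x, ⟨G, hG, hGω, rfl⟩, hx⟩ :=
    (csInf_lt_iff (slopeSet_bddBelow hω h0) slopeSet_nonempty).1 hlt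
  refine ⟨G, hG, hGω, ?_⟩
  rw [div_lt_iff₀ (sub_pos.2 hω)] at hx
  linarith

/-- **The inf-version of the cap iff**: `(∀ ε > 0, SlopeCap t a (μ' + ε)) ⟺ μ* ≤ μ'` (`ω > 2`).
[cite: Strassen1988, Thm. 2.3–2.4] -/
theorem forall_slopeCap_iff_sInf_le (hω : 2 < omega ℂ) (h0 : SlopeFloor t a 0) {s' : ℝ} :
    (∀ ε : ℝ, 0 < ε → SlopeCap t a (s' + ε)) ↔
    sInf {x : ℝ | ∃ F : SpectralMap ℂ, IsUniversalSpectralPoint ℂ F ∧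
      Real.logb 2 (F (matMulTensor ℂ 2 2 2)) = omega ℂ ∧
      (Real.logb 2 (F t) - a) / (omega ℂ - 2) = x} ≤ s' := by
  constructor
  · intro h
    refine le_of_forall_pos_lt_add fun ε hε => ?_
    have h1 := sInf_le_of_slopeCap hω h0 (h (ε / 2) (by positivity))
    linarith
  · intro h ε hε
    exact slopeCap_of_sInf_lt hω h0 (by linarith)

/-- **Attained version**: if the inf is a min (`μ* ∈` slope set), then `SlopeCap t a μ' ⟺ μ* ≤ μ'`.
(Attainment would follow from compactness of the top fibre, which `SpectralMap` does not provide;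
it is a hypothesis here.) [cite: Strassen1988, Thm. 2.3–2.4] -/
theorem slopeCap_iff_of_mem (hω : 2 < omega ℂ) (h0 : SlopeFloor t a 0)
    (hmem : sInf {x : ℝ | ∃ F : SpectralMap ℂ, IsUniversalSpectralPoint ℂ F ∧
      Real.logb 2 (F (matMulTensor ℂ 2 2 2)) = omega ℂ ∧
      (Real.logb 2 (F t) - a) / (omega ℂ - 2) = x} ∈
      {x : ℝ | ∃ F : SpectralMap ℂ, IsUniversalSpectralPoint ℂ F ∧
      Real.logb 2 (F (matMulTensor ℂ 2 2 2)) = omega ℂ ∧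
      (Real.logb 2 (F t) - a) / (omega ℂ - 2) = x}) {s' : ℝ} :
    SlopeCap t a s' ↔
    sInf {x : ℝ | ∃ F : SpectralMap ℂ, IsUniversalSpectralPoint ℂ F ∧
      Real.logb 2 (F (matMulTensor ℂ 2 2 2)) = omega ℂ ∧
      (Real.logb 2 (F t) - a) / (omega ℂ - 2) = x} ≤ s' := by
  refine ⟨sInf_le_of_slopeCap hω h0, fun hle => ?_⟩
  obtain ⟨G, hG, hGω, hGx⟩ := hmem
  refine ⟨G, hG, hGω, ?_⟩
  have h1 : (Real.logb 2 (G t) - a) / (omega ℂ - 2) ≤ s' := by rw [hGx]; exact hle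
  rw [div_le_iff₀ (sub_pos.2 hω)] at h1
  linarith

/-- **No room between the half-lines** (`ω > 2`): `TopFloor t a μ` and `SlopeCap t a μ'` force `μ ≤ μ'`
— the contrapositive reading of `summit_of_topFloor_of_cap`. [cite: Strassen1988, Thm. 2.3–2.4] -/
theorem le_of_topFloor_of_cap (hω : 2 < omega ℂ) {s s' : ℝ}
    (htop : ∀ F : SpectralMap ℂ, IsUniversalSpectralPoint ℂ F →
      Real.logb 2 (F (matMulTensor ℂ 2 2 2)) = omega ℂ → a + s * (omega ℂ - 2) ≤ Real.logb 2 (F t))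
    (hcap : SlopeCap t a s') : s ≤ s' := by
  by_contra hlt
  have hS := summit_of_topFloor_of_cap (lt_of_not_ge hlt) htop hcap
  have : omega ℂ = 2 := (_root_.MatrixMultiplication_iff).1 hS
  linarith

/-- **Upper bound for `μ*`** from a height bound `log₂F(t) ≤ b` on universal points:
`μ* ≤ (b − a)/(ω − 2)` (`ω > 2`; the top point itself). [cite: Strassen1988, Thm. 2.4] -/
theorem sInf_le_of_bound (hω : 2 < omega ℂ) (h0 : SlopeFloor t a 0) {b : ℝ}
    (hb : ∀ F : SpectralMap ℂ, IsUniversalSpectralPoint ℂ F → Real.logb 2 (F t) ≤ b) :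
    sInf {x : ℝ | ∃ F : SpectralMap ℂ, IsUniversalSpectralPoint ℂ F ∧
      Real.logb 2 (F (matMulTensor ℂ 2 2 2)) = omega ℂ ∧
      (Real.logb 2 (F t) - a) / (omega ℂ - 2) = x} ≤ (b - a) / (omega ℂ - 2) :=
  sInf_le_of_slopeCap hω h0
    (slopeCap_of_le_mul hb (le_of_eq (div_mul_cancel₀ _ (sub_pos.2 hω).ne').symm))

/-- **Lower bound for `μ*`** from a universal floor: `SlopeFloor t a μ ⟹ μ ≤ μ*` (`ω > 2`).
[cite: Strassen1988, Thm. 2.4] -/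
theorem le_sInf_of_slopeFloor (hω : 2 < omega ℂ) (h0 : SlopeFloor t a 0) {s : ℝ}
    (hfl : SlopeFloor t a s) :
    s ≤ sInf {x : ℝ | ∃ F : SpectralMap ℂ, IsUniversalSpectralPoint ℂ F ∧
      Real.logb 2 (F (matMulTensor ℂ 2 2 2)) = omega ℂ ∧
      (Real.logb 2 (F t) - a) / (omega ℂ - 2) = x} :=
  (topFloor_iff_le_sInf hω h0).1 (topFloor_of_slopeFloor hfl)

end Generic

/-! ## §3  The corner `(2, log₂ 3)` for `cw₂`: `1/3 ≤ μ* ≤ (2 − log₂3)/(ω − 2)` and the residual -/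

section Cw

/-- `1/3 ≤ μ*(cw₂)` (`ω > 2`): the laser floor `SlopeFloor cw₂ (log₂3) (1/3)` (Coppersmith–Winograd).
[cite: CoppersmithWinograd1990, §6] -/
theorem third_le_sInf_cw (hω : 2 < omega ℂ) :
    (1 / 3 : ℝ) ≤ sInf {x : ℝ | ∃ F : SpectralMap ℂ, IsUniversalSpectralPoint ℂ F ∧
      Real.logb 2 (F (matMulTensor ℂ 2 2 2)) = omega ℂ ∧
      (Real.logb 2 (F (cwTensor ℂ 2)) - Real.logb 2 3) / (omega ℂ - 2) = x} :=
  le_sInf_of_slopeFloor hω cwFloor_zero cwFloor_third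

/-- `μ*(cw₂) ≤ (2 − log₂3)/(ω − 2)` (`ω > 2`): the height bound `log₂F(cw₂) ≤ 2` (`R(cw₂) ≤ 4`).
[cite: CoppersmithWinograd1990, §6] -/
theorem sInf_cw_le (hω : 2 < omega ℂ) :
    sInf {x : ℝ | ∃ F : SpectralMap ℂ, IsUniversalSpectralPoint ℂ F ∧
      Real.logb 2 (F (matMulTensor ℂ 2 2 2)) = omega ℂ ∧
      (Real.logb 2 (F (cwTensor ℂ 2)) - Real.logb 2 3) / (omega ℂ - 2) = x} ≤
      (2 - Real.logb 2 3) / (omega ℂ - 2) :=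
  sInf_le_of_bound hω cwFloor_zero xExp_le_two_all

/-- Every slope in the `cw₂` slope set is `≥ 1/3` (laser floor at the top point).
[cite: CoppersmithWinograd1990, §6] -/
theorem third_le_of_mem_slopeSet_cw (hω : 2 < omega ℂ) {x : ℝ}
    (hx : x ∈ {x : ℝ | ∃ F : SpectralMap ℂ, IsUniversalSpectralPoint ℂ F ∧
      Real.logb 2 (F (matMulTensor ℂ 2 2 2)) = omega ℂ ∧
      (Real.logb 2 (F (cwTensor ℂ 2)) - Real.logb 2 3) / (omega ℂ - 2) = x}) :
    (1 / 3 : ℝ) ≤ x := by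
  obtain ⟨F, hF, hFω, rfl⟩ := hx
  have h1 := cwFloor_third F hF
  rw [hFω] at h1
  rw [le_div_iff₀ (sub_pos.2 hω)]
  linarith

/-- **The residual of record on the top-slope scale** (`ω > 2`):
`LaserMergeOptimal ⟺ 1/3 ∈ (cw₂ slope set)` — i.e. `μ* = 1/3` AND the inf is attained.
[cite: CoppersmithWinograd1990, §6; Strassen1988, Thm. 2.3–2.4] -/
theorem laserMergeOptimal_iff_third_mem (hω : 2 < omega ℂ) :
    LaserMergeOptimal ↔ (1 / 3 : ℝ) ∈ {x : ℝ | ∃ F : SpectralMap ℂ, IsUniversalSpectralPoint ℂ F ∧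
      Real.logb 2 (F (matMulTensor ℂ 2 2 2)) = omega ℂ ∧
      (Real.logb 2 (F (cwTensor ℂ 2)) - Real.logb 2 3) / (omega ℂ - 2) = x} := by
  rw [← cwCap_third_iff]
  have hpos : 0 < omega ℂ - 2 := sub_pos.2 hω
  constructor
  · rintro ⟨G, hG, hGω, hGcap⟩
    have hfl := cwFloor_third G hG
    rw [hGω] at hfl
    refine ⟨G, hG, hGω, ?_⟩
    rw [div_eq_iff hpos.ne']
    linarith
  · rintro ⟨G, hG, hGω, hGx⟩
    refine ⟨G, hG, hGω, ?_⟩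
    rw [div_eq_iff hpos.ne'] at hGx
    linarith

/-- `LaserMergeOptimal ⟹ μ*(cw₂) = 1/3` (`ω > 2`). [cite: CoppersmithWinograd1990, §6] -/
theorem sInf_cw_eq_third_of_laserMergeOptimal (hω : 2 < omega ℂ) (h : LaserMergeOptimal) :
    sInf {x : ℝ | ∃ F : SpectralMap ℂ, IsUniversalSpectralPoint ℂ F ∧
      Real.logb 2 (F (matMulTensor ℂ 2 2 2)) = omega ℂ ∧
      (Real.logb 2 (F (cwTensor ℂ 2)) - Real.logb 2 3) / (omega ℂ - 2) = x} = 1 / 3 :=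
  le_antisymm (sInf_le_of_slopeCap hω cwFloor_zero (cwCap_third_iff.2 h)) (third_le_sInf_cw hω)

/-- **`μ*(cw₂) = 1/3 ⟺ ∀ ε > 0, SlopeCap cw₂ (log₂3) (1/3 + ε)`** (`ω > 2`): the inf-version of the
residual — `LaserMergeOptimal` up to attainment. [cite: CoppersmithWinograd1990, §6; Strassen1988, Thm. 2.3–2.4] -/
theorem sInf_cw_eq_third_iff (hω : 2 < omega ℂ) :
    sInf {x : ℝ | ∃ F : SpectralMap ℂ, IsUniversalSpectralPoint ℂ F ∧
      Real.logb 2 (F (matMulTensor ℂ 2 2 2)) = omega ℂ ∧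
      (Real.logb 2 (F (cwTensor ℂ 2)) - Real.logb 2 3) / (omega ℂ - 2) = x} = 1 / 3 ↔
    ∀ ε : ℝ, 0 < ε → SlopeCap (cwTensor ℂ 2) (Real.logb 2 3) (1 / 3 + ε) := by
  rw [forall_slopeCap_iff_sInf_le hω cwFloor_zero]
  exact ⟨le_of_eq, fun h => le_antisymm h (third_le_sInf_cw hω)⟩

/-- **The two half-lines, unconditionally** (no branch hypothesis): for `1/3 < μ`,
`TopFloor cw₂ (log₂3) μ ∧ LaserMergeOptimal ⟹ ω = 2` — the attacked side may be weakened to the top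
floor without touching the cut (`LaserTangency ⟸ SlopeFloor cw₂ (log₂3) μ` is g31's `laserTangency_of_cwFloor`).
[cite: CoppersmithWinograd1990, §6; Strassen1988, Thm. 2.3–2.4] -/
theorem summit_of_topFloor_cw_of_laserMergeOptimal {s : ℝ} (hs : 1 / 3 < s)
    (htop : ∀ F : SpectralMap ℂ, IsUniversalSpectralPoint ℂ F →
      Real.logb 2 (F (matMulTensor ℂ 2 2 2)) = omega ℂ →
        Real.logb 2 3 + s * (omega ℂ - 2) ≤ Real.logb 2 (F (cwTensor ℂ 2)))
    (h : LaserMergeOptimal) : _root_.MatrixMultiplication :=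
  summit_of_topFloor_of_cap hs htop (cwCap_third_iff.2 h)

/-- And conversely `ω = 2 ⟹ TopFloor cw₂ (log₂3) μ` for every `μ`. [cite: Strassen1988, Thm. 2.4] -/
theorem topFloor_cw_of_summit (hS : _root_.MatrixMultiplication) (s : ℝ) :
    ∀ F : SpectralMap ℂ, IsUniversalSpectralPoint ℂ F →
      Real.logb 2 (F (matMulTensor ℂ 2 2 2)) = omega ℂ →
        Real.logb 2 3 + s * (omega ℂ - 2) ≤ Real.logb 2 (F (cwTensor ℂ 2)) :=
  topFloor_of_summit hS cwFloor_zero s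

end Cw

end Summit.MatrixMultiplication.MatrixMultiplication.Theorems.OutsiderSandwichTopSlope
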